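import Summits.Ventures.HodgeRepro2.HeckeSpectralReal
import Summits.Ventures.HodgeRepro2.HolomorphicFiniteDimensional
import Summits.Ventures.HodgeRepro2.AtkinLehnerEigenvalues
import Summits.Ventures.HodgeRepro2.LevelNormalizer
import Summits.Ventures.HodgeRepro2.MultiplicityOnePeriod
import Summits.Ventures.HodgeRepro2.HodgePeterssonBridge
import Summits.Ventures.HodgeRepro2.BallQuotientCompactTransfer
import Summits.Ventures.HodgeRepro2.BallFundamentalDomainExists
import Summits.Ventures.HodgeRepro2.LevelNeat
import Summits.Ventures.HodgeRepro2.WeightThreeForm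
import Summits.Ventures.HodgeRepro2.DoubleCosetMem
import Summits.Ventures.HodgeRepro2.AtkinLehnerPeriod

/-!
# NormalCoreClosing — the (N)-period closing statement with a congruence group `S'` NORMAL in `Γ₁`: every
involution of `Γ₁` normalises `S'`, so the partner of the vertex form has a definite Atkin–Lehner sign
(p2 annex row 172)

Cell pub-hodge-repro2, Tier 5 kernel annex (seat p2, Shimura-data / Hecke side). Proof lane (no new definition).
§8(d): uses an L-value-free non-vanishing device: NO.

Rows 141 / 151 / 155 / 164 produce the torsion-free congruence group `S' ⊆ Γ_N` of the (N)-period chain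
existentially, so row 164's Atkin–Lehner sign was conditional on «`δ` normalises `S'`». Here the chain is
re-assembled from its general ingredients with a CHOSEN group: the Tier-3 input gives a finite-index
`Γ ≤ Γ₁` carrying a non-zero holomorphic weight-3 form `f` (`NonVanishingInput.exists_isAutomorphicForm_ne_zero`,
row 82); `S' := ` the NORMAL CORE in `Γ₁` of `Γ ⊓ Γ_N` (`Subgroup.normalCore`, mapped back into `GL₃(K)`) is a
torsion-free congruence group of finite index in `Γ₁` (`Subgroup.finiteIndex_normalCore`), NORMAL in `Γ₁`, with
compact quotient (`compactSpace_ballQuotient_of_le`, row 113) and a fundamental domain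
(`exists_isBallFundamentalDomain`, row 101); `f` is a weight-3 form for `S'` with `[f] ≠ 0`; for every
`δ ∈ U(H)(K)` with `δ⁻¹ ∈ S'δS'` the real spectral theorem of row 143 and the projection argument of row 127
(`exists_inner_ne_zero_of_setIntegral_hodgeWedge_ne_zero`, `f` paired with itself) give a holomorphic
`T_δ`-eigenform `g` with REAL eigenvalue and `∫_D ω_f ∧ conj ω_g ≠ 0` (`holRep`, row 134).
**`NonVanishingInput.exists_normal_hecke_eigenform_hodgePeriod_ne_zero`** states all of this, and its corollary
**`NonVanishingInput.exists_normal_atkinLehner_sign`**: for EVERY involution `δ ∈ Γ₁` (e.g. the coordinate sign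
changes of rows 168–169 for the diagonal Picard form, which lie in `Γ₁`) the partner satisfies
`T_δ [g] = [g]` or `T_δ [g] = −[g]` (row 148) — the Atkin–Lehner sign of the (N)-period partner, now UNCONDITIONAL.

No `sorry`; `#print axioms` ⊆ {propext, Classical.choice, Quot.sound}.
-/

namespace Summit.Ventures.HodgeRepro2.ShimuraData

variable {K : Type*} [Field K] [NumberField K] [NumberField.IsCMField K]
  {τ₁ : K →+* ℂ} {H : Matrix (Fin 3) (Fin 3) K} {Q : Matrix (Fin 3) (Fin 3) ℂ}

/-- THE CLOSING STATEMENT WITH A NORMAL CONGRUENCE GROUP. The Tier-3 input gives a torsion-free congruence group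
`S' ⊆ Γ_N` of finite index in `Γ₁`, NORMAL in `Γ₁`, with compact quotient and a fundamental domain `D`, a
holomorphic weight-3 form `f ≢ 0` for `S'`, and for every `δ ∈ U(H)(K)` with `δ⁻¹ ∈ S'δS'` a holomorphic
`T_δ`-eigenform `g` with real eigenvalue and `∫_D ω_f ∧ conj ω_g ≠ 0`. -/
theorem NonVanishingInput.exists_normal_hecke_eigenform_hodgePeriod_ne_zero
    {𝔪 : Submodule ℤ (Fin 3 → K)} (hH : IsHermitianForm K H)
    (hdef : ∀ τ : K →+* ℂ, NumberField.InfinitePlace.mk τ ≠ NumberField.InfinitePlace.mk τ₁ →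
      IsDefiniteAt K τ H)
    (hQ : IsFrame K τ₁ H Q) (h𝔪 : IsLattice K 𝔪) (hnv : NonVanishingInput K τ₁ H 𝔪 Q)
    {N : ℕ} (hN : 2 < N)
    [CompactSpace (ballQuotient hQ (shimuraLevelSubgroup K H 𝔪 1)
      (shimuraLevelSubgroup_one_subset_unitaryGroup H 𝔪))] :
    ∃ S' : Subgroup (GL (Fin 3) K), ∃ hS' : (S' : Set (GL (Fin 3) K)) ⊆ shimuraLevel K H 𝔪 N,
      IsTorsionFreeSet K (S' : Set (GL (Fin 3) K)) ∧
      (∀ γ ∈ shimuraLevelSubgroup K H 𝔪 1, ∀ s : GL (Fin 3) K, s ∈ S' ↔ γ * s * γ⁻¹ ∈ S') ∧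
      ∃ (hS₁ : S' ≤ shimuraLevelSubgroup K H 𝔪 1)
        (hfin : (S'.subgroupOf (shimuraLevelSubgroup K H 𝔪 1)).FiniteIndex)
        (_hc : CompactSpace (ballQuotient hQ S'
          (hS'.trans (shimuraLevelSubgroup_subset_unitaryGroup H 𝔪 N)))),
      ∃ D : Set ball₂, ∃ (hDm : MeasurableSet D)
        (hD : IsBallFundamentalDomain hQ S' (hS'.trans (shimuraLevelSubgroup_subset_unitaryGroup H 𝔪 N)) D),
      ∃ f ∈ holomorphicForms hQ S' (hS'.trans (shimuraLevelSubgroup_subset_unitaryGroup H 𝔪 N)) 3 hD,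
        SeparationQuotient.mk f ≠ 0 ∧
        ∀ δ : unitaryGroup K H, (δ : GL (Fin 3) K)⁻¹ ∈ doubleCoset S' δ →
          ∃ g ∈ holomorphicForms hQ S' (hS'.trans (shimuraLevelSubgroup_subset_unitaryGroup H 𝔪 N)) 3 hD,
            (∃ r : ℝ, heckeFamilyOf hQ S' (hS'.trans (shimuraLevelSubgroup_subset_unitaryGroup H 𝔪 N)) 3 hD
                hDm (fun δ => fintypeHeckeQuotientOfFiniteIndex h𝔪 hS₁ hfin δ.2) δ
                (SeparationQuotient.mk g) = (r : ℂ) • SeparationQuotient.mk g) ∧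
            ∫ x in (Subtype.val '' D),
              hodgeWedge
                (PeterssonForms.toForm hQ S' (hS'.trans (shimuraLevelSubgroup_subset_unitaryGroup H 𝔪 N))
                  3 hD f : (Fin 2 → ℂ) → ℂ)
                (PeterssonForms.toForm hQ S' (hS'.trans (shimuraLevelSubgroup_subset_unitaryGroup H 𝔪 N))
                  3 hD g : (Fin 2 → ℂ) → ℂ) x ≠ 0 := by
  -- the Tier-3 input: a finite-index `Γ ≤ Γ₁` and a non-zero holomorphic weight-3 form for `Γ`
  obtain ⟨Γ, ⟨S, T, hSΓ, hT, hST, hfinST⟩, f, ⟨hfhol, hfaut⟩, z₀, hz₀, hfz₀⟩ :=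
    NonVanishingInput.exists_isAutomorphicForm_ne_zero hQ hnv
  -- `T` is `Γ₁`
  have hT' : T = shimuraLevelSubgroup K H 𝔪 1 :=
    SetLike.coe_injective (hT.trans (coe_shimuraLevelSubgroup K H 𝔪 1).symm)
  subst hT'
  haveI hfinN : ((shimuraLevelSubgroup K H 𝔪 N).subgroupOf (shimuraLevelSubgroup K H 𝔪 1)).FiniteIndex :=
    finiteIndex_subgroupOf_shimuraLevel H 𝔪 h𝔪 (by omega)
  haveI hfinS : (S.subgroupOf (shimuraLevelSubgroup K H 𝔪 1)).FiniteIndex := hfinST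
  -- the normal core of `Γ ⊓ Γ_N` in `Γ₁`
  haveI hfin0 : ((S ⊓ shimuraLevelSubgroup K H 𝔪 N).subgroupOf (shimuraLevelSubgroup K H 𝔪 1)).FiniteIndex := by
    rw [show (S ⊓ shimuraLevelSubgroup K H 𝔪 N).subgroupOf (shimuraLevelSubgroup K H 𝔪 1) =
      S.subgroupOf (shimuraLevelSubgroup K H 𝔪 1) ⊓
        (shimuraLevelSubgroup K H 𝔪 N).subgroupOf (shimuraLevelSubgroup K H 𝔪 1) from
      Subgroup.comap_inf _ _ _]
    infer_instance
  obtain ⟨A, hA⟩ : ∃ A : Subgroup (shimuraLevelSubgroup K H 𝔪 1),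
      A = ((S ⊓ shimuraLevelSubgroup K H 𝔪 N).subgroupOf (shimuraLevelSubgroup K H 𝔪 1)).normalCore := ⟨_, rfl⟩
  haveI hAfin : A.FiniteIndex := by rw [hA]; exact Subgroup.finiteIndex_normalCore _
  haveI hAnorm : A.Normal := by rw [hA]; exact Subgroup.normalCore_normal _
  obtain ⟨S', hS'def⟩ : ∃ S' : Subgroup (GL (Fin 3) K), S' = A.map (shimuraLevelSubgroup K H 𝔪 1).subtype :=
    ⟨_, rfl⟩
  have hS'le : S' ≤ S ⊓ shimuraLevelSubgroup K H 𝔪 N := by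
    rw [hS'def, Subgroup.map_le_iff_le_comap, hA]
    exact Subgroup.normalCore_le _
  have hS'N : (S' : Set (GL (Fin 3) K)) ⊆ shimuraLevel K H 𝔪 N := fun x hx =>
    (hS'le hx).2
  have hS'S : S' ≤ S := fun x hx => (hS'le hx).1
  have hS'1 : S' ≤ shimuraLevelSubgroup K H 𝔪 1 := hS'S.trans hST
  have hS'sub : S'.subgroupOf (shimuraLevelSubgroup K H 𝔪 1) = A := by
    rw [hS'def]
    exact Subgroup.comap_map_eq_self_of_injective (Subgroup.subtype_injective _) A
  haveI hS'fin : (S'.subgroupOf (shimuraLevelSubgroup K H 𝔪 1)).FiniteIndex := by rw [hS'sub]; exact hAfin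
  have htf : IsTorsionFreeSet K (S' : Set (GL (Fin 3) K)) :=
    (isTorsionFreeSet_shimuraLevel τ₁ H h𝔪 hN).mono hS'N
  -- normality in `Γ₁`
  have key : ∀ g ∈ shimuraLevelSubgroup K H 𝔪 1, ∀ t ∈ S', g * t * g⁻¹ ∈ S' := by
    intro g hg t ht
    have ht1 : t ∈ shimuraLevelSubgroup K H 𝔪 1 := hS'1 ht
    have htA : (⟨t, ht1⟩ : shimuraLevelSubgroup K H 𝔪 1) ∈ A := by
      rw [← hS'sub]; exact ht
    have hconj : (⟨g, hg⟩ * ⟨t, ht1⟩ * ⟨g, hg⟩⁻¹ : shimuraLevelSubgroup K H 𝔪 1) ∈ A :=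
      hAnorm.conj_mem _ htA _
    have hmem : (⟨g, hg⟩ * ⟨t, ht1⟩ * ⟨g, hg⟩⁻¹ : shimuraLevelSubgroup K H 𝔪 1) ∈
        S'.subgroupOf (shimuraLevelSubgroup K H 𝔪 1) := by
      rw [hS'sub]; exact hconj
    rw [Subgroup.mem_subgroupOf] at hmem
    simpa using hmem
  have hnormal : ∀ γ ∈ shimuraLevelSubgroup K H 𝔪 1, ∀ s : GL (Fin 3) K, s ∈ S' ↔ γ * s * γ⁻¹ ∈ S' := by
    intro γ hγ s
    refine ⟨key γ hγ s, fun h => ?_⟩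
    have := key γ⁻¹ ((shimuraLevelSubgroup K H 𝔪 1).inv_mem hγ) _ h
    simpa [mul_assoc] using this
  -- compact quotient and a fundamental domain for `S'`
  have hS'U : (S' : Set (GL (Fin 3) K)) ⊆ unitaryGroup K H :=
    hS'N.trans (shimuraLevelSubgroup_subset_unitaryGroup H 𝔪 N)
  haveI hc : CompactSpace (ballQuotient hQ S' hS'U) :=
    compactSpace_ballQuotient_of_le hQ hS'1 (shimuraLevelSubgroup_one_subset_unitaryGroup H 𝔪)
  obtain ⟨D, hDm, hD⟩ := exists_isBallFundamentalDomain hH hdef hQ h𝔪 hS'N htf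
  -- `f` is a weight-3 form for `S'`
  have hfw : IsWeightFor τ₁ Q S' 3 f := by
    intro γ hγ z hz
    exact hfaut _ ⟨γ, hSΓ ▸ hS'S hγ, rfl⟩ z hz
  have hfmem : f ∈ weightForms τ₁ Q S' 3 := (mem_weightForms τ₁ Q S' 3).mpr ⟨hfw, hfhol.continuousOn⟩
  set fP : PeterssonForms hQ S' hS'U 3 hD := PeterssonForms.ofForm hQ S' hS'U 3 hD ⟨f, hfmem⟩ with hfP
  have hfPhol : fP ∈ holomorphicForms hQ S' hS'U 3 hD := hfhol
  have hfP0 : SeparationQuotient.mk fP ≠ 0 :=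
    (PeterssonSpace.mk_ne_zero_iff hQ S' hS'U 3 hD fP).mpr ⟨z₀, hz₀, hfz₀⟩
  refine ⟨S', hS'N, htf, hnormal, hS'1, hS'fin, hc, D, hDm, hD, fP, hfPhol, hfP0, fun δ hδ => ?_⟩
  -- the real spectral theorem for `T_δ` and the projection argument
  obtain ⟨b, hb⟩ := exists_orthonormalBasis_heckeSpace_holomorphic_real_of_inv_mem_doubleCoset hH hdef hQ h𝔪
    hS'N hS'1 hS'fin 3 hD hDm δ hδ
  have hself : ∫ x in (Subtype.val '' D),
      hodgeWedge (PeterssonForms.toForm hQ S' hS'U 3 hD fP : (Fin 2 → ℂ) → ℂ)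
        (PeterssonForms.toForm hQ S' hS'U 3 hD fP : (Fin 2 → ℂ) → ℂ) x ≠ 0 := by
    intro h0
    have hpos := setIntegral_hodgeWedge_self_re_pos hQ S' hS'U hD hDm hfw hfhol.continuousOn hz₀ hfz₀
    rw [show (PeterssonForms.toForm hQ S' hS'U 3 hD fP : (Fin 2 → ℂ) → ℂ) = f from rfl, h0] at *
    simp at hpos
  obtain ⟨a, -, ha⟩ := exists_inner_ne_zero_of_setIntegral_hodgeWedge_ne_zero hQ S' hS'U hD hDm
    (holomorphicSpace hQ S' hS'U 3 hD) b fP fP (Submodule.mem_map_of_mem hfPhol) (Submodule.mem_map_of_mem hfPhol)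
    hself
  obtain ⟨r, hr⟩ := hb a
  refine ⟨holRep hQ S' hS'U 3 hD (b a), holRep_mem hQ S' hS'U 3 hD (b a), ⟨r, ?_⟩, ?_⟩
  · rw [mk_holRep, hr]
  · rw [setIntegral_hodgeWedge_eq_inner_mk hQ S' hS'U hD hDm, mk_holRep]
    exact mul_ne_zero (by norm_num) ha

/-- THE UNCONDITIONAL ATKIN–LEHNER SIGN: with the normal congruence group `S'` of the previous theorem, for EVERY
involution `δ ∈ Γ₁` (it normalises `S'`) the real-eigenvalue partner `g` of the vertex form has `T_δ [g] = [g]`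
or `T_δ [g] = −[g]` and `∫_D ω_f ∧ conj ω_g ≠ 0` (row 148, row 164's argument). -/
theorem NonVanishingInput.exists_normal_atkinLehner_sign
    {𝔪 : Submodule ℤ (Fin 3 → K)} (hH : IsHermitianForm K H)
    (hdef : ∀ τ : K →+* ℂ, NumberField.InfinitePlace.mk τ ≠ NumberField.InfinitePlace.mk τ₁ →
      IsDefiniteAt K τ H)
    (hQ : IsFrame K τ₁ H Q) (h𝔪 : IsLattice K 𝔪) (hnv : NonVanishingInput K τ₁ H 𝔪 Q)
    {N : ℕ} (hN : 2 < N)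
    [CompactSpace (ballQuotient hQ (shimuraLevelSubgroup K H 𝔪 1)
      (shimuraLevelSubgroup_one_subset_unitaryGroup H 𝔪))] :
    ∃ S' : Subgroup (GL (Fin 3) K), ∃ hS' : (S' : Set (GL (Fin 3) K)) ⊆ shimuraLevel K H 𝔪 N,
      IsTorsionFreeSet K (S' : Set (GL (Fin 3) K)) ∧
      (∀ γ ∈ shimuraLevelSubgroup K H 𝔪 1, ∀ s : GL (Fin 3) K, s ∈ S' ↔ γ * s * γ⁻¹ ∈ S') ∧
      ∃ (hS₁ : S' ≤ shimuraLevelSubgroup K H 𝔪 1)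
        (hfin : (S'.subgroupOf (shimuraLevelSubgroup K H 𝔪 1)).FiniteIndex)
        (_hc : CompactSpace (ballQuotient hQ S'
          (hS'.trans (shimuraLevelSubgroup_subset_unitaryGroup H 𝔪 N)))),
      ∃ D : Set ball₂, ∃ (hDm : MeasurableSet D)
        (hD : IsBallFundamentalDomain hQ S' (hS'.trans (shimuraLevelSubgroup_subset_unitaryGroup H 𝔪 N)) D),
      ∃ f ∈ holomorphicForms hQ S' (hS'.trans (shimuraLevelSubgroup_subset_unitaryGroup H 𝔪 N)) 3 hD,
        SeparationQuotient.mk f ≠ 0 ∧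
        ∀ δ : unitaryGroup K H, (δ : GL (Fin 3) K) ∈ shimuraLevelSubgroup K H 𝔪 1 →
          (δ : GL (Fin 3) K) * δ = 1 →
          ∃ g ∈ holomorphicForms hQ S' (hS'.trans (shimuraLevelSubgroup_subset_unitaryGroup H 𝔪 N)) 3 hD,
            SeparationQuotient.mk g ≠ 0 ∧
            (heckeFamilyOf hQ S' (hS'.trans (shimuraLevelSubgroup_subset_unitaryGroup H 𝔪 N)) 3 hD
                hDm (fun δ => fintypeHeckeQuotientOfFiniteIndex h𝔪 hS₁ hfin δ.2) δ
                (SeparationQuotient.mk g) = SeparationQuotient.mk g ∨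
              heckeFamilyOf hQ S' (hS'.trans (shimuraLevelSubgroup_subset_unitaryGroup H 𝔪 N)) 3 hD
                hDm (fun δ => fintypeHeckeQuotientOfFiniteIndex h𝔪 hS₁ hfin δ.2) δ
                (SeparationQuotient.mk g) = -SeparationQuotient.mk g) ∧
            ∫ x in (Subtype.val '' D),
              hodgeWedge
                (PeterssonForms.toForm hQ S' (hS'.trans (shimuraLevelSubgroup_subset_unitaryGroup H 𝔪 N))
                  3 hD f : (Fin 2 → ℂ) → ℂ)
                (PeterssonForms.toForm hQ S' (hS'.trans (shimuraLevelSubgroup_subset_unitaryGroup H 𝔪 N))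
                  3 hD g : (Fin 2 → ℂ) → ℂ) x ≠ 0 := by
  obtain ⟨S', hS', htf, hnormal, hS₁, hfin, hc, D, hDm, hD, f, hf, hf0, hδ⟩ :=
    NonVanishingInput.exists_normal_hecke_eigenform_hodgePeriod_ne_zero hH hdef hQ h𝔪 hnv hN
  refine ⟨S', hS', htf, hnormal, hS₁, hfin, hc, D, hDm, hD, f, hf, hf0, fun δ hδ1 hδ2 => ?_⟩
  obtain ⟨g, hg, ⟨r, hr⟩, hper⟩ := hδ δ (inv_mem_doubleCoset_of_sq_mem (by rw [hδ2]; exact S'.one_mem))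
  have hg0 : SeparationQuotient.mk g ≠ 0 := mk_ne_zero_of_setIntegral_hodgeWedge_ne_zero hQ S' _ hD hDm hper
  refine ⟨g, hg, hg0, ?_, hper⟩
  rcases heckeFamilyOf_eigenvalue_eq_one_or_neg_one_of_normalizes_of_sq_eq_one hQ S' _ 3 hD hDm _
      (hnormal δ hδ1) hδ2 hg0 hr with h1 | h1
  · left; rw [hr, h1, one_smul]
  · right; rw [hr, h1, neg_one_smul]

end Summit.Ventures.HodgeRepro2.ShimuraData
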